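import Literature.AnabelianGeometry.SemiGraphs.TemperedPiPointSeqFibreIso
import Literature.AnabelianGeometry.SemiGraphs.TemperedPiVerticialLevelData
import HarnessLib

/-!
# The levels `𝒢_{∞,n}` of the Galois tower as objects of `B^temp(π₁^temp(𝒢))`: transitive, with
# base-point stabiliser `ker ρ_n` ([SemiAnbd] Prop 3.6 (ii) p. 38, Rmk 3.1.2 p. 33)

Mochizuki, *Semi-graphs of anabelioids*, Publ. RIMS **42** (2006), §3 p. 38 ("`G_{∞,i} → G` is a
Galois tempered covering … `π₁^temp(G) := lim Gal(G_{∞,i}/G)`"), Prop 3.6 (ii) (the equivalence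
`B^temp(π₁^temp(G)) ⥲ B^temp(G)`), Rmk 3.1.2 p. 33 (the objects `Π/H`) [cite: MochizukiSemiAnbd2006, Prop 3.6(ii) p.38].

PROOF-ONLY file (no definitions; seat abc-iut-L3-t9, the Galois-tower lineage).  For Galois level data
`D` (`TemperedPiSystem/Existence/Action/Fibre.lean`) the fibre over the base vertex of the level covering
`𝒢_{∞,n} = D.cover n` with its `π₁^temp(𝒢)`-action — the object `Φ(𝒢_{∞,n})` (`GaloisLevelData.fibreObj`)
of the fibre functor of Prop 3.6 (ii) — is identified with the coset object `π₁^temp(𝒢)/ker ρ_n` of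
Rmk 3.1.2 through its base point: using abc-iut-L3-t8's `piAct_cover_bp` ("`γ · bp_n = ρ_n(γ)⁻¹ bp_n`",
`TemperedPiPointSeqFibreIso.lean`),

* `piAct_cover_bp_eq_self_iff` — the STABILISER of `bp_n` in `π₁^temp(𝒢)` is `ker ρ_n` (rigidity:
  `Gal(𝒢_{∞,n}/𝒢)` acts freely on the fibre, `aut_eq_of_apply_bp`);
* `exists_piAct_cover_bp_eq` — `π₁^temp(𝒢)` acts TRANSITIVELY on the fibre of `𝒢_{∞,n}` over the base
  vertex (`Gal(𝒢_{∞,n}/𝒢)` does since the levels are point-transitive, `exists_aut_apply_eq'`; `ρ_n` is onto);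
* `fibreObj_cover_transitive` / `mem_ker_proj_iff_fibreObj_cover` — the same two facts read on the
  object `Φ(𝒢_{∞,n})`, and `coverT_transitive` / `mem_ker_proj_iff_coverT` — for the chart
  `𝒢.temperedPiChart h36` (`TemperedPiChartExists.lean`) applied to abc-iut-L3-t8's `𝒢.coverT h36 n`
  (`TemperedPiVerticialLevelData.lean`).

These are the inputs `htrans` / `hstab` of `TemperedLevelStability.levelStable_of_btempPullback_isos`
(cell row T54-B, residual E1: the levels `ker ρ_n` are stable under the arithmetic outer action as soon
as the COVERINGS `𝒢_{∞,n}` are stable under the graph action).  Nothing here refers to the IUT corpus;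
no side is taken on [IUTchIII] Cor 3.12; typed ≠ proved.
-/

namespace Literature.AnabelianGeometry.SemiGraphs

namespace ProfiniteSemiGraph

open CategoryTheory

universe u

variable {𝒢 : ProfiniteSemiGraph.{u}}

namespace GaloisLevelData

variable (D : GaloisLevelData 𝒢) (h𝒢 : 𝒢.IsCountable) (n : ℕ)
  (hn : (D.S n).Splits ((D.cover h𝒢 n).component (Sum.inl ⟨D.v₀, D.bp n⟩)))
  (lev : ((D.cover h𝒢 n).SV D.v₀).obj.V → ℕ)
  (hlev : ∀ (s : ((D.cover h𝒢 n).SV D.v₀).obj.V) (m : ℕ), lev s ≤ m →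
    (D.S m).Splits ((D.cover h𝒢 n).component (Sum.inl ⟨D.v₀, s⟩)))

include hn

/-- **The stabiliser of `bp_n` in `π₁^temp(𝒢)` is `ker ρ_n`**: `γ · bp_n = bp_n ↔ ρ_n(γ) = 1`
(`γ · bp_n = ρ_n(γ)⁻¹ bp_n` and `Gal(𝒢_{∞,n}/𝒢)` acts freely on the fibre, by rigidity).
[cite: MochizukiSemiAnbd2006, Prop 3.6(ii) p.38] -/
theorem piAct_cover_bp_eq_self_iff (γ : D.temperedPi h𝒢) :
    D.piAct h𝒢 (D.cover h𝒢 n) lev hlev γ (D.bp n) = D.bp n ↔ D.proj h𝒢 n γ = 1 := by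
  rw [D.piAct_cover_bp h𝒢 n hn lev hlev γ]
  constructor
  · intro h
    have h1 : ((D.proj h𝒢 n γ)⁻¹ : D.Gal h𝒢 n) = 1 :=
      D.aut_eq_of_apply_bp h𝒢 n _ _ (h.trans (by rfl))
    exact inv_eq_one.mp h1
  · intro h
    rw [h, inv_one]
    rfl

/-- **`π₁^temp(𝒢)` acts transitively on the fibre of `𝒢_{∞,n}` over the base vertex** (`Gal(𝒢_{∞,n}/𝒢)`
does — the levels are point-transitive — and `ρ_n` is onto). [cite: MochizukiSemiAnbd2006, Prop 3.6(ii) p.38] -/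
theorem exists_piAct_cover_bp_eq (y : ((D.cover h𝒢 n).SV D.v₀).obj.V) :
    ∃ γ : D.temperedPi h𝒢, D.piAct h𝒢 (D.cover h𝒢 n) lev hlev γ (D.bp n) = y := by
  obtain ⟨η, hη⟩ := (D.S n).exists_aut_apply_eq' h𝒢 (D.W n) (D.htrans n) (D.bp n) y
  obtain ⟨γ, hγ⟩ := D.proj_surjective h𝒢 n (η : D.Gal h𝒢 n)⁻¹
  refine ⟨γ, ?_⟩
  rw [D.piAct_cover_bp h𝒢 n hn lev hlev γ, hγ, inv_inv]
  exact hη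

/-- `B^temp` form: the object `Φ(𝒢_{∞,n})` (`fibreObj`) is TRANSITIVE from `bp_n`.
[cite: MochizukiSemiAnbd2006, Prop 3.6(ii) p.38] -/
theorem fibreObj_cover_transitive (y : ((D.cover h𝒢 n).SV D.v₀).obj.V) :
    ∃ γ : D.temperedPi h𝒢, (D.fibreObj h𝒢 (D.cover h𝒢 n) lev hlev).obj.ρ γ (D.bp n) = y :=
  D.exists_piAct_cover_bp_eq h𝒢 n hn lev hlev y

/-- `B^temp` form: the stabiliser of the point `bp_n` of `Φ(𝒢_{∞,n})` is `ker ρ_n`.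
[cite: MochizukiSemiAnbd2006, Prop 3.6(ii) p.38] -/
theorem mem_ker_proj_iff_fibreObj_cover (γ : D.temperedPi h𝒢) :
    γ ∈ (D.proj h𝒢 n).ker ↔ (D.fibreObj h𝒢 (D.cover h𝒢 n) lev hlev).obj.ρ γ (D.bp n) = D.bp n := by
  rw [MonoidHom.mem_ker]
  exact (D.piAct_cover_bp_eq_self_iff h𝒢 n hn lev hlev γ).symm

end GaloisLevelData

/-! ### For the chart `𝒢.temperedPiChart h36` and the coverings `𝒢.coverT h36 n = 𝒢_{∞,S n}` -/

section Chart

variable (𝒢) (h36 : 𝒢.Prop36Hypotheses) (n : ℕ)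

/-- **The chart image of `𝒢_{∞,n}` is transitive from its base point `bp_n`.**
[cite: MochizukiSemiAnbd2006, Prop 3.6(ii) p.38] -/
theorem coverT_transitive
    (y : (((𝒢.galoisLevelData h36).cover h36.isCountable n).SV (𝒢.baseVertex h36)).obj.V) :
    ∃ γ : (𝒢.temperedPiChart h36).G,
      ((𝒢.temperedPiChart h36).equiv.functor.obj (𝒢.coverT h36 n)).obj.ρ γ ((𝒢.galoisLevelData h36).bp n) = y :=
  (𝒢.galoisLevelData h36).fibreObj_cover_transitive h36.isCountable n
    (𝒢.galoisLevelData_splits_component_bp h36 n) _ _ y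

/-- **The stabiliser of `bp_n` in the chart image of `𝒢_{∞,n}` is the level `ker ρ_n`.**
[cite: MochizukiSemiAnbd2006, Prop 3.6(ii) p.38] -/
theorem mem_ker_proj_iff_coverT (γ : (𝒢.temperedPiChart h36).G) :
    γ ∈ ((𝒢.galoisLevelData h36).proj h36.isCountable n).ker ↔
      ((𝒢.temperedPiChart h36).equiv.functor.obj (𝒢.coverT h36 n)).obj.ρ γ ((𝒢.galoisLevelData h36).bp n) =
        (𝒢.galoisLevelData h36).bp n :=
  (𝒢.galoisLevelData h36).mem_ker_proj_iff_fibreObj_cover h36.isCountable n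
    (𝒢.galoisLevelData_splits_component_bp h36 n) _ _ γ

end Chart

end ProfiniteSemiGraph

end Literature.AnabelianGeometry.SemiGraphs
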